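import Summits.HubbardSuperconductivity.HubbardSuperconductivity.Theorems.BalabanIRBirGroundStateAverageLROBounds

/-!
# Route `BalabanIR`, crux 5 `BirEveryGroundState` (item `stmt-HubbardSuperconductivity-2083`): average → every, the reduction

The crux asks: if on an open window of couplings the ground-state AVERAGE of `Δ_d† Δ_d` over the
sector ground eigenspace `E₀(U, L)` of `hubbardTorus 2 L 1 U` is `≥ c L⁴` eventually in even `L`,
then at SOME coupling of the window EVERY admissible sequence of normalised sector ground states has
`d_{x²-y²}` pair-field long-range order (the summit's matrix). This file proves, sorry-free, the
part of the intended Kato–Schur argument (cards `generic-u-schur-every-gs`,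
`commutant-schur-pair-invariance`) that does not depend on the open genericity question, and
isolates that question as an explicit hypothesis:

* `hasLRO_of_forall_groundState_bound` — at ONE coupling `U`: an eventual every-ground-state bound
  `c L⁴ ≤ ⟨ψ, Δ_d† Δ_d ψ⟩` (even `L ≥ L₀`) gives the summit's conclusion for every admissible
  sequence (`liminf` bookkeeping; the sequence is constrained at even sides only);
* `birEveryGroundState_of_everyGroundState_transfer` — hence the crux follows from any mechanism
  turning the window-average hypothesis into such a bound at one coupling of the window;
* `forall_unit_le_re_of_scalar` — if the compression of `A` to `K ≠ ⊥` is a scalar (matrix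
  elements `⟨w, A v⟩ = μ ⟨w, v⟩` on `K`), the trace (average) bound `c · tr P_K ≤ re tr (P_K A)`
  holds for EVERY unit vector of `K`;
* `birEveryGroundState_of_scalarOnGround` — THE REDUCTION: if for every `δ ∈ (0, 1/2)` the set of
  couplings `U > 0` at which `Δ_d† Δ_d` is eventually (in even `L`) a scalar on `E₀(U, L)` meets
  every open window `(U₁, U₂) ⊂ (0, ∞)`, then `BirEveryGroundState` holds. The hypothesis is the
  operational content of "for generic `U` the ground multiplet is irreducible and Schur applies"
  (Schur itself: `exists_scalar_matrixElements_of_irreducible` in the companion file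
  `BalabanIRBirEveryGroundStateSchur.lean`); it is NOT proved here — the crux is closed modulo it.

Tasaki (2020) §2.1, App. A.2; Scalapino, Phys. Rep. 250 (1995) 329, §2 eq. (2.4); Friedli–Velenik
(2017) §3.7.2; Kato (1966) II §6.1 for the context. Everything is folklore; no definition is
introduced.
-/

noncomputable section

namespace Summit.HubbardSuperconductivity.HubbardSuperconductivity.Theorems

open Matrix Finset Filter
open Literature.Probability.LatticeModels Literature.MathematicalPhysics.QuantumLattice
open Summit.HubbardSuperconductivity.HubbardSuperconductivity.Theses.BalabanIR
open scoped ComplexOrder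

/-! ### Scalar compression ⇒ every unit vector carries the average -/

section Scalar

variable {n : Type*} [Fintype n] [DecidableEq n]

/-- **Scalar on `K` ⇒ every = average.** If all matrix elements of `A` between vectors of `K ≠ ⊥`
are those of a scalar, `⟨w, A v⟩ = μ ⟨w, v⟩`, then the average bound `c · re tr P_K ≤ re tr (P_K A)`
(`P_K` the projection matrix onto the Euclidean transport of `K`) holds for EVERY unit vector of
`K`: `c ≤ re ⟨ψ, A ψ⟩`. (Pigeonhole gives one good unit vector, whose expectation `re μ` is
everybody's.) [folklore] -/
theorem forall_unit_le_re_of_scalar (K : Submodule ℂ (n → ℂ)) (hK : K ≠ ⊥) (A : Matrix n n ℂ)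
    (c : ℝ) (hscalar : ∃ μ : ℂ, ∀ v ∈ K, ∀ w ∈ K, star w ⬝ᵥ A *ᵥ v = μ * (star w ⬝ᵥ v))
    (h : c * (projMatrix (K.map
        ((WithLp.linearEquiv 2 ℂ (n → ℂ)).symm : (n → ℂ) →ₗ[ℂ] EuclideanSpace ℂ n))).trace.re ≤
      (projMatrix (K.map
        ((WithLp.linearEquiv 2 ℂ (n → ℂ)).symm : (n → ℂ) →ₗ[ℂ] EuclideanSpace ℂ n)) * A).trace.re) :
    ∀ ψ ∈ K, star ψ ⬝ᵥ ψ = 1 → c ≤ (star ψ ⬝ᵥ A *ᵥ ψ).re := by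
  obtain ⟨μ, hμ⟩ := hscalar
  obtain ⟨ψ₀, hψ₀, hunit₀, hle⟩ := exists_unit_le_re_of_trace_projMatrix_map K hK A c h
  intro ψ hψ hunit
  rw [hμ ψ hψ ψ hψ, hunit, mul_one]
  rw [hμ ψ₀ hψ₀ ψ₀ hψ₀, hunit₀, mul_one] at hle
  exact hle

end Scalar

/-! ### The Hubbard glue: every-ground-state bound ⇒ the summit's matrix; the reduction -/

section Hubbard

/-- **Every-ground-state bound at one coupling ⇒ the summit's matrix at that coupling.** Fix `U`,
`δ` and `c > 0`. If for all even sides `L ≥ L₀` EVERY normalised ground state `ψ` of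
`hubbardTorus 2 L 1 U` in the sector `(2⌊(1-δ)L²/2⌋, S^z = 0)` obeys `c L⁴ ≤ re ⟨ψ, Δ_d† Δ_d ψ⟩`,
then every admissible sequence `(N, ψ)` (prescribed particle number, normalisation and ground-state
property at the even sides) has `d_{x²-y²}` pair-field long-range order along the even sides,
`HasLongRangeOrder (fun k => halfOpenBox 2 (2k)) (fun k => torusPullback (pairFieldCorr d ψ) (2k))`:
the LRO sequence is eventually `≥ c` (`torusLROSeq_pairFieldCorr_succ`) and bounded above by `C_d²`
at every `k ≥ 1` (`pairFieldCorr_succ_le`, using only the normalisation at side `2k`), so its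
`liminf` is `≥ c > 0`. Scalapino, Phys. Rep. 250 (1995) 329, §2 eq. (2.4); Friedli–Velenik (2017)
§3.7.2. [folklore] -/
theorem hasLRO_of_forall_groundState_bound (U δ c : ℝ) (hc : 0 < c) (L₀ : ℕ)
    (h : ∀ (L : ℕ) [NeZero L], L₀ ≤ L → Even L → ∀ ψ : Fock (Orb (FermionTorus 2 L)),
      IsGroundStateInSector (hubbardTorus 2 L 1 U) (2 * ⌊(1 - δ) * (L : ℝ) ^ 2 / 2⌋₊) 0 ψ →
      star ψ ⬝ᵥ ψ = 1 →
      c * (L : ℝ) ^ 4 ≤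
        (star ψ ⬝ᵥ ((pairField dWaveFormFactor L)ᴴ * pairField dWaveFormFactor L) *ᵥ ψ).re)
    (N : ℕ → ℕ) (ψ : ∀ L, Fock (Orb (FermionTorus 2 L)))
    (hadm : ∀ L, Even L → N L = 2 * ⌊(1 - δ) * (L : ℝ) ^ 2 / 2⌋₊ ∧ star (ψ L) ⬝ᵥ ψ L = 1 ∧
      IsGroundStateInSector (hubbardTorus 2 L 1 U) (N L) 0 (ψ L)) :
    HasLongRangeOrder (fun k => halfOpenBox 2 (2 * k))
      (fun k => torusPullback (pairFieldCorr dWaveFormFactor ψ) (2 * k)) := by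
  unfold HasLongRangeOrder
  set Cd : ℝ := ∑ e ∈ insert 0 unitSteps, ‖((dWaveFormFactor e / Real.sqrt 2 : ℝ) : ℂ)‖ * 2
    with hCd
  -- the LRO sequence at a positive side `m + 1`, for a vector normalised there, is `≤ C_d²`
  have hup' : ∀ m : ℕ, star (ψ (m + 1)) ⬝ᵥ ψ (m + 1) = 1 →
      (∑ x ∈ halfOpenBox 2 (m + 1), ∑ y ∈ halfOpenBox 2 (m + 1),
        torusPullback (pairFieldCorr dWaveFormFactor ψ) (m + 1) x y) /
          ((halfOpenBox 2 (m + 1)).card : ℝ) ^ 2 ≤ Cd ^ 2 := by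
    intro m hnorm
    rw [torusLROSeq_pairFieldCorr_succ, div_le_iff₀ (by positivity), ← sum_pairFieldCorr_succ]
    calc ∑ x : TorusSite 2 (m + 1), ∑ y, pairFieldCorr dWaveFormFactor ψ (m + 1) x y
        ≤ ∑ _x : TorusSite 2 (m + 1), ∑ _y : TorusSite 2 (m + 1), Cd ^ 2 :=
          Finset.sum_le_sum fun x _ => Finset.sum_le_sum fun y _ =>
            pairFieldCorr_succ_le dWaveFormFactor ψ m hnorm x y
      _ = Cd ^ 2 * ((m + 1 : ℕ) : ℝ) ^ 4 := by
          simp only [Finset.sum_const, Finset.card_univ, EnslavedA1g.card_torusSite_two,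
            nsmul_eq_mul]
          push_cast
          ring
  -- the LRO sequence at a good even side `m + 1 ≥ L₀` is `≥ c`
  have hlow' : ∀ m : ℕ, L₀ ≤ m + 1 → Even (m + 1) →
      c ≤ (∑ x ∈ halfOpenBox 2 (m + 1), ∑ y ∈ halfOpenBox 2 (m + 1),
        torusPullback (pairFieldCorr dWaveFormFactor ψ) (m + 1) x y) /
          ((halfOpenBox 2 (m + 1)).card : ℝ) ^ 2 := by
    intro m hm hev
    obtain ⟨hN, hunit, hgs⟩ := hadm (m + 1) hev
    rw [hN] at hgs
    have hb := h (m + 1) hm hev (ψ (m + 1)) hgs hunit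
    rw [torusLROSeq_pairFieldCorr_succ, le_div_iff₀ (by positivity)]
    exact hb
  -- upper bound at every `k` (uses only the normalisation at the even side `2k`)
  have hup : ∀ k : ℕ, (∑ x ∈ halfOpenBox 2 (2 * k), ∑ y ∈ halfOpenBox 2 (2 * k),
      torusPullback (pairFieldCorr dWaveFormFactor ψ) (2 * k) x y) /
        ((halfOpenBox 2 (2 * k)).card : ℝ) ^ 2 ≤ Cd ^ 2 := by
    intro k
    cases k with
    | zero =>
      have h0 : ((halfOpenBox 2 (2 * 0)).card : ℝ) ^ 2 = 0 := by rw [card_halfOpenBox]; simp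
      rw [h0, div_zero]
      positivity
    | succ k =>
      have hev : Even (2 * k + 1 + 1) := ⟨k + 1, by ring⟩
      exact hup' (2 * k + 1) (hadm (2 * k + 1 + 1) hev).2.1
  -- lower bound, eventually
  have hlow : ∀ᶠ k : ℕ in atTop, c ≤ (∑ x ∈ halfOpenBox 2 (2 * k), ∑ y ∈ halfOpenBox 2 (2 * k),
      torusPullback (pairFieldCorr dWaveFormFactor ψ) (2 * k) x y) /
        ((halfOpenBox 2 (2 * k)).card : ℝ) ^ 2 := by
    refine eventually_atTop.2 ⟨L₀ + 1, fun k hk => ?_⟩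
    obtain ⟨k, rfl⟩ : ∃ k', k = k' + 1 := ⟨k - 1, by omega⟩
    have hev : Even (2 * k + 1 + 1) := ⟨k + 1, by ring⟩
    exact hlow' (2 * k + 1) (by omega) hev
  exact lt_of_lt_of_le hc
    (le_liminf_of_le (isCoboundedUnder_ge_of_eventually_le _ (Eventually.of_forall hup)) hlow)

/-- **Every-ground-state bounds on the window ⇒ the crux.** `BirEveryGroundState` follows as soon
as, for all data `(δ, U₁, U₂, c)` of its hypothesis, the ground-state-AVERAGE bound on the window
yields ONE coupling `U ∈ (U₁, U₂)`, a constant `c' > 0` and a threshold beyond which every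
normalised sector ground state at even sides has `c' L⁴ ≤ re ⟨ψ, Δ_d† Δ_d ψ⟩`
(`hasLRO_of_forall_groundState_bound`). This is the exact shape any mechanism for average → every
has to deliver. [folklore] -/
theorem birEveryGroundState_of_everyGroundState_transfer
    (h : ∀ (δ U₁ U₂ c : ℝ), δ ∈ Set.Ioo (0:ℝ) (1/2) → 0 < U₁ → U₁ < U₂ → 0 < c →
      (∀ U ∈ Set.Ioo U₁ U₂, ∃ L₀ : ℕ, ∀ (L : ℕ) [NeZero L], L₀ ≤ L → Even L →
        let N : ℕ := 2 * ⌊(1 - δ) * (L : ℝ) ^ 2 / 2⌋₊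
        let H := hubbardTorus 2 L 1 U
        let S := szSector (Λ := FermionTorus 2 L) N 0
        let E₀ := S ⊓ Module.End.eigenspace (Matrix.toLin' H) ((H.minEnergyOn S : ℝ) : ℂ)
        let P := projMatrix (E₀.map (Fock.toEuclidean (ι := Orb (FermionTorus 2 L)) :
          Fock (Orb (FermionTorus 2 L)) →ₗ[ℂ] EuclideanSpace ℂ (Finset (Orb (FermionTorus 2 L)))))
        c * (L : ℝ) ^ 4 * P.trace.re ≤
          (P * ((pairField dWaveFormFactor L)ᴴ * pairField dWaveFormFactor L)).trace.re) →
      ∃ U ∈ Set.Ioo U₁ U₂, ∃ c' : ℝ, 0 < c' ∧ ∃ L₀ : ℕ, ∀ (L : ℕ) [NeZero L], L₀ ≤ L → Even L →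
        ∀ ψ : Fock (Orb (FermionTorus 2 L)),
          IsGroundStateInSector (hubbardTorus 2 L 1 U) (2 * ⌊(1 - δ) * (L : ℝ) ^ 2 / 2⌋₊) 0 ψ →
          star ψ ⬝ᵥ ψ = 1 →
          c' * (L : ℝ) ^ 4 ≤
            (star ψ ⬝ᵥ ((pairField dWaveFormFactor L)ᴴ * pairField dWaveFormFactor L) *ᵥ ψ).re) :
    BirEveryGroundState := by
  intro δ U₁ U₂ c hδ hU₁ hU₁₂ hc hyp
  obtain ⟨U, hU, c', hc', L₀, hL₀⟩ := h δ U₁ U₂ c hδ hU₁ hU₁₂ hc hyp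
  exact ⟨U, hU, fun N ψ hadm =>
    hasLRO_of_forall_groundState_bound U δ c' hc' L₀ (fun L _ hL hLe => hL₀ L hL hLe) N ψ hadm⟩

/-- **THE REDUCTION `BirEveryGroundState` ⇐ scalar ground compressions at a dense set of
couplings.** Suppose that for every `δ ∈ (0, 1/2)` and every open window `(U₁, U₂) ⊂ (0, ∞)` there
is a coupling `U` in the window at which, eventually in even `L`, the `d`-wave pair structure
factor `Δ_d† Δ_d` has scalar matrix elements on the sector ground eigenspace
`E₀(U, L) = szSector N_L 0 ⊓ ker (H - e₀)` of `H = hubbardTorus 2 L 1 U`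
(`⟨w, Δ_d† Δ_d v⟩ = μ ⟨w, v⟩` for `v, w ∈ E₀`; by `exists_scalar_matrixElements_of_irreducible`
this holds whenever `E₀(U, L)` is irreducible under a family of symmetries of `H` commuting with
`Δ_d† Δ_d` — the Kato–Schur genericity bet of the crux). Then `BirEveryGroundState`: at that `U`
the window's average bound `c L⁴ re tr P ≤ re tr (P Δ_d† Δ_d)` is carried by every normalised
ground state (`forall_unit_le_re_of_scalar`, `E₀ ≠ ⊥` by `hubbardTorus_groundEigenspace_ne_bot`),
and `hasLRO_of_forall_groundState_bound` concludes. The genericity hypothesis is NOT proved here;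
this theorem is the crux closed modulo it. Kato (1966) II §6.1; Serre §2.2. [folklore] -/
theorem birEveryGroundState_of_scalarOnGround
    (hgen : ∀ δ ∈ Set.Ioo (0:ℝ) (1/2), ∀ U₁ U₂ : ℝ, 0 < U₁ → U₁ < U₂ →
      ∃ U ∈ Set.Ioo U₁ U₂, ∃ L₀ : ℕ, ∀ (L : ℕ) [NeZero L], L₀ ≤ L → Even L →
        let N : ℕ := 2 * ⌊(1 - δ) * (L : ℝ) ^ 2 / 2⌋₊
        let H := hubbardTorus 2 L 1 U
        let S := szSector (Λ := FermionTorus 2 L) N 0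
        let E₀ := S ⊓ Module.End.eigenspace (Matrix.toLin' H) ((H.minEnergyOn S : ℝ) : ℂ)
        ∃ μ : ℂ, ∀ v ∈ E₀, ∀ w ∈ E₀,
          star w ⬝ᵥ ((pairField dWaveFormFactor L)ᴴ * pairField dWaveFormFactor L) *ᵥ v =
            μ * (star w ⬝ᵥ v)) :
    BirEveryGroundState := by
  refine birEveryGroundState_of_everyGroundState_transfer
    fun δ U₁ U₂ c hδ hU₁ hU₁₂ hc hyp => ?_
  obtain ⟨U, hU, L₁, hL₁⟩ := hgen δ hδ U₁ U₂ hU₁ hU₁₂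
  obtain ⟨L₂, hL₂⟩ := hyp U hU
  refine ⟨U, hU, c, hc, max L₁ L₂, fun L _ hL hLe ψ hgs hunit => ?_⟩
  -- name the objects of side `L`
  set A : Matrix (Finset (Orb (FermionTorus 2 L))) (Finset (Orb (FermionTorus 2 L))) ℂ :=
    (pairField dWaveFormFactor L)ᴴ * pairField dWaveFormFactor L with hA
  set H := hubbardTorus 2 L 1 U with hH
  set S := szSector (Λ := FermionTorus 2 L) (2 * ⌊(1 - δ) * (L : ℝ) ^ 2 / 2⌋₊) 0 with hS
  set E₀ := S ⊓ Module.End.eigenspace (Matrix.toLin' H) ((H.minEnergyOn S : ℝ) : ℂ) with hE₀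
  have hscal : ∃ μ : ℂ, ∀ v ∈ E₀, ∀ w ∈ E₀, star w ⬝ᵥ A *ᵥ v = μ * (star w ⬝ᵥ v) :=
    hL₁ L ((le_max_left _ _).trans hL) hLe
  have havg : c * (L : ℝ) ^ 4 * (projMatrix (E₀.map
      (Fock.toEuclidean (ι := Orb (FermionTorus 2 L)) :
        Fock (Orb (FermionTorus 2 L)) →ₗ[ℂ]
          EuclideanSpace ℂ (Finset (Orb (FermionTorus 2 L)))))).trace.re ≤
      (projMatrix (E₀.map (Fock.toEuclidean (ι := Orb (FermionTorus 2 L)) :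
        Fock (Orb (FermionTorus 2 L)) →ₗ[ℂ]
          EuclideanSpace ℂ (Finset (Orb (FermionTorus 2 L))))) * A).trace.re :=
    hL₂ L ((le_max_right _ _).trans hL) hLe
  rw [map_toEuclidean_eq] at havg
  have hδ' : (-1 : ℝ) ≤ δ := by linarith [hδ.1]
  have hne : E₀ ≠ ⊥ := hubbardTorus_groundEigenspace_ne_bot 2 L 1 U
    (m := ⌊(1 - δ) * (L : ℝ) ^ 2 / 2⌋₊)
    (by rw [NoGo.card_fermionTorus_two]; exact NoGo.floor_pairNumber_le δ hδ' L)
  have hψE : ψ ∈ E₀ := by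
    refine Submodule.mem_inf.mpr ⟨hgs.1, ?_⟩
    rw [Module.End.mem_eigenspace_iff, Matrix.toLin'_apply]
    exact hgs.2.2
  exact forall_unit_le_re_of_scalar E₀ hne A (c * (L : ℝ) ^ 4) hscal havg ψ hψE hunit

end Hubbard

end Summit.HubbardSuperconductivity.HubbardSuperconductivity.Theorems
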